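import Summits.AtomisticToContinuum.Crystallization.Theorems.FreeSplittingCertificatesStrictSplittingRuleTorusModelGen
import Summits.AtomisticToContinuum.Crystallization.Theorems.FreeSplittingCertificatesStrictSplittingRuleTorusModel552Tables

/-!
# The joint (r6) sitewise LMI on the hcp torus 5×5×2 (100 sites, 300 coordinates) — model-level, via the generic-shape model

Route `FreeSplittingCertificates`, crux `StrictSplittingRule` (stmt-AtomisticToContinuum-12560); unit b2b-freesplit-B (block 2b,
PART B, gen 1).  **VALUE = theorems about a FINITE model — NOT summit progress**; `stub_coreJointCoercive` is not proved.

Instantiation of `…TorusModelGen.lean` at `(NK, N1) = (4, 5)` (torus `ℤ₄ × ℤ₅ × ℤ₅`, the 5×5×2 torus of CERT.md §0): forms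
`supply5 / transfer5 / demand5 / normSqG5 / meanProj5`, witness tables `tableRaw552` (kit j037532), β = `betaTable` (the 4×4×2 data —
identical for every torus), margin `margin552 = 17171/2²⁰ = 0.016376` (the gen-0 exactly certified margin, CERT.md §0), the assembled
matrices `mat5A / mat5B` and rounded `LDLᵀ` factors `fact5A / fact5B` (computed in Lean).  Theorems: `…TorusModel552A.lean`, `…552B.lean`.
[folklore]
-/

namespace Summit.AtomisticToContinuum.Crystallization.Theorems.StrictSplittingRuleTorusLMI

open Literature.Computation.Certificates

/-- Decoded transfer classes of the 5×5×2 torus. [folklore] -/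
def tableClasses552 : List (Bool × Off × Bool × Bool × List ℤ) :=
  tableRaw552.filterMap fun r =>
    match r with
    | b :: dk :: di :: dj :: bq :: full :: ents => some (b == 1, (dk, di, dj), bq == 1, full == 1, ents)
    | _ => none

/-- The certified margin `m = 17171/2²⁰ = 0.016376` (identity-normalised, Cartesian norm). -/
def margin552 : ℚ := 17171 / 2 ^ 20

/-- Reference A site `(0,0,0)` of the 5×5×2 torus. -/
def siteA5 : SiteG 4 5 := ((0 : Fin 4), (0 : Fin 5), (0 : Fin 5))
/-- Reference B site `(1,0,0)` of the 5×5×2 torus. -/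
def siteB5 : SiteG 4 5 := ((1 : Fin 4), (0 : Fin 5), (0 : Fin 5))

/-- SUPPLY `S_p(u)` (5×5×2). [folklore] -/
def supply5 (p : SiteG 4 5) (u : Fin (dimG 4 5) → ℚ) : ℚ := evalQ (supplyTermsG 4 5 p (thetaListG 4 5 p)) u
/-- TRANSFERS `T_p(u)` (5×5×2). [folklore] -/
def transfer5 (p : SiteG 4 5) (u : Fin (dimG 4 5) → ℚ) : ℚ := evalQ (transferTermsG 4 5 p tableClasses552) u
/-- DEMAND `D_p(u)` = κ-terms + readout form (5×5×2). [folklore] -/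
def demand5 (p : SiteG 4 5) (u : Fin (dimG 4 5) → ℚ) : ℚ :=
  evalQ (kappaTermsG 4 5 p (thetaListG 4 5 p)) u + evalQ (readoutTermsG 4 5 p (thetaListG 4 5 p) betaTable) u
/-- `‖u‖²_G` (5×5×2). [folklore] -/
def normSqG5 (u : Fin (dimG 4 5) → ℚ) : ℚ := evalQ (normTermsG 4 5) u
/-- `meanProj u = Σ_c (g_c/100)(Σ_q u_(q,c))²` (5×5×2). [folklore] -/
def meanProj5 (u : Fin (dimG 4 5) → ℚ) : ℚ := evalQ (projTermsG 4 5) u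

/-- The certificate's form (κ-scaling 1): `S + T − D − m‖u‖² + meanProj`. [folklore] -/
theorem evalQ_certTermsG_552 (p : SiteG 4 5) (m : ℚ) (u : Fin (dimG 4 5) → ℚ) :
    evalQ (certTermsG 4 5 p 1 m tableClasses552) u =
      supply5 p u + transfer5 p u - demand5 p u - m * normSqG5 u + meanProj5 u := by
  simp only [certTermsG, evalQ_append, evalQ_negTermsN, evalQ_scaleTermsN, supply5, transfer5, demand5, normSqG5, meanProj5]
  ring

/-- `meanProj5` vanishes on zero-mean fields. [folklore] -/
theorem meanProj5_eq_zero {u : Fin (dimG 4 5) → ℚ} (h0 : ∀ c : Fin 3, (sumFG 4 5 c).eval u = 0) : meanProj5 u = 0 := by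
  simp [meanProj5, projTermsG, sqN, evalQ_cons, h0]

/-- Assembled accumulator, 5×5×2 parity A. -/
def acc5A : Acc (dimG 4 5) := assemble (certTermsG 4 5 siteA5 1 margin552 tableClasses552)
/-- Assembled accumulator, 5×5×2 parity B. -/
def acc5B : Acc (dimG 4 5) := assemble (certTermsG 4 5 siteB5 1 margin552 tableClasses552)
/-- Symmetrised matrix of the certificate's form, parity A (reducible, so that `isGramCertDD_symm_of_rows` applies). -/
abbrev mat5A : Matrix (Fin (dimG 4 5)) (Fin (dimG 4 5)) ℚ := symm acc5A.toMatrix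
/-- Symmetrised matrix, parity B. -/
abbrev mat5B : Matrix (Fin (dimG 4 5)) (Fin (dimG 4 5)) ℚ := symm acc5B.toMatrix
/-- Rounded `LDLᵀ` factor of `mat5A − 10⁻³·1` (40 bits), computed in Lean. -/
def fact5A : Array ℚ × Array (Array ℚ) := certArrays 40 (1 / 1000) mat5A
/-- Rounded `LDLᵀ` factor of `mat5B − 10⁻³·1`, computed in Lean. -/
def fact5B : Array ℚ × Array (Array ℚ) := certArrays 40 (1 / 1000) mat5B

end Summit.AtomisticToContinuum.Crystallization.Theorems.StrictSplittingRuleTorusLMI
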